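import Literature.AlgebraicGeometry.ModuliOfAbelianVarieties.SiegelAdmissibleExistence
import Literature.AlgebraicGeometry.ModuliOfAbelianVarieties.SiegelMarkingTowerFramesSymplectic
import Literature.AlgebraicGeometry.Motives.AbelianVarietyWeilPairingNormalForm
import HarnessLib

/-!
# Admissibility of a principal representative from ONE analytic input: the pairing readings of a level-one marking
# ([Milne 2005] Thm. 6.11; [Deligne 1971] 4.12 (b), 4.16; [Lan 2013] Lemma 1.3.6.5)

Topic `AlgebraicGeometry/ModuliOfAbelianVarieties`; namespace `Literature.AlgebraicGeometry.ModuliOfAbelianVarieties`.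
KERNEL ONLY: theorems; no definition, no named fact, no instance, no `sorry`.  Cell `hodgecm-mathlib`, rung-0 U-DAG
brick **B4 (d)**, second assembly layer over ★ `exists_isAdmissibleAt_of_frame` (`SiegelAdmissibleExistence`): the
symplectic lift `Λ₀` and the integral frame `k₀ ∈ K_δ(1)` of that theorem are DISCHARGED — `Λ₀` by the liftability
field `P′.symplectic` (★ D3 `IsSymplecticLiftable.nonempty`), `k₀` by the inverse-limit frame of ★
`SiegelAdelicMarking.exists_frame_of_symplecticLift` (`SiegelMarkingTowerFramesSymplectic`, over ★
`IntegralAdelesInverseLimit`: «`GSp_δ(ẑ) = lim GSp_δ(ℤ/M)`»), whose own pairing binder is supplied by the frame change ★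
`SiegelAdelicMarking.exists_pairingRead_of_pairingRead`.  What remains as the ONLY analytic input of the (U3) existence
clause is `hpair`: the Weil pairing of an ample `Θ` on torsion points read through some `b ∈ K_δ(1)` by a level-one
marking `m₀` of the fibre is `ζ_M ^ E_δ` — the D5 identity «algebraic `ē^Θ_M` = `e(2πi·M·c₁(Θ^an))`» (★
`AbelianVariety.weilPairingLevel_eq_cexp`) read in a Siegel normal form of `c₁(Θ^an)` of type `δ`.
HC_CM is proved only modulo the 7 printed citations until rung 0 closes.

* **`exists_isAdmissibleAt_of_pairingRead`** — from `P′` over `Spec ℂ`, an ample `Θ` with `λ̄ = Λ(𝒪(Θ))` at the point,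
  a marking `m₀` of the fibre by `[J(Z₀), a₀]` (`a₀ ∈ K_δ(1)`) and its pairing readings `hpair` through `b ∈ K_δ(1)`:
  the (U3) data `(c, u, r)` (clauses of ★ `SiegelShimuraSet.exists_principalRep` verbatim) and `Z ∈ 𝔥_g` with
  `IsAdmissibleAt hδ r Z hZ P′`.
* **`exists_isAdmissibleAt_of_pairingRead_of_polarization`** — the same with `Θ` ranging over the ample witnesses of
  `P′.pol` at the point (★ D2 `Polarization.exists_ample`), i.e. with the hypothesis «for every ample witness `Θ` some
  level-one marking has pairing readings `ζ_M ^ E_δ`».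
* **`exists_isAdmissibleAt_of_normalForm`** — `hpair` DISCHARGED by the D5 normal form ★
  `AbelianVariety.weilPairingLevel_eq_exp_pow_typeFormMod` (`ζ_M = e(2πi/M)`): the remaining input is a NORMAL-FORM
  MARKING — a re-framed uniformisation `(Φ″, φ″)` of the fibre indexed by `Fin g ⊕ Fin g` with an Appell–Humbert datum
  `p` of `[𝒪(Θ)^an]` whose integer Gram matrix is `E_δ` (`intGram Φ″ p.form = typeForm δ`), and a level-one marking
  `m₀` by `[J(Z₀), a₀]` whose torsion parametrisation is `u₀(v) = φ″[ṽ]` — pure complex-analytic data (Frobenius basis of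
  `c₁(Θ^an)` + Siegel normal form), no Weil pairing left in the hypotheses.

## References
* [Milne2005ShimuraVarieties] J. S. Milne, *Introduction to Shimura varieties* (2005), §6 Thm. 6.11 pp. 74–75, §12 (63).
* [Deligne1971TravauxShimura] P. Deligne, *Travaux de Shimura* (1971), 4.12 (b) pp. 148–149, Exemple 4.16 p. 150.
* [Lan2013PELCompactifications] K.-W. Lan, *Arithmetic compactifications of PEL-type Shimura varieties* (2013), §1.3.6
  Def. 1.3.6.2 (p. 80), Lemma 1.3.6.5 (p. 81).
-/

set_option autoImplicit false

noncomputable section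

open Matrix NumberField IsDedekindDomain CategoryTheory AlgebraicGeometry

namespace Literature.AlgebraicGeometry.ModuliOfAbelianVarieties

open Literature.AlgebraicGeometry.Motives (AbelianVariety AlgPoints CartierDivisor specOver)
open Literature.AlgebraicGeometry.AbelianSchemes (AbelianSchemeOver PolarizedAbelianSchemeWithLevel)
open Literature.NumberTheory.Adeles
open Literature.NumberTheory.Automorphic (siegelUpperHalfSpace)
open SiegelModuli

variable {g : ℕ} {δ : Fin g → ℕ}

/-- **ADMISSIBILITY OF A PRINCIPAL REPRESENTATIVE FROM THE PAIRING READINGS OF A LEVEL-ONE MARKING** ((U3)∃ of ★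
`siegelModuli_complexUniformisation` with ONE analytic input; [Milne2005ShimuraVarieties] Thm. 6.11 «to `(A, s, ηK)`
attach `[J, a]`»; [Deligne1971TravauxShimura] 4.12 (b), 4.16; [Lan2013PELCompactifications] Lemma 1.3.6.5).
DATA: `δ` a polarisation type, `0 < g`, `N ≠ 0`; `P′` a polarised abelian scheme of type `δ` with level-`N` structure
over `Spec ℂ`; an ample divisor `Θ` on the fibre with `λ̄ = Λ(𝒪(Θ))` there; a marking `m₀` of the fibre by `[J(Z₀), a₀]`,
`a₀ ∈ K_δ(1)`; a compatible system of primitive roots `ζ` for which the Weil pairing of `Θ` on torsion points read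
through some `b ∈ K_δ(1)` is `ζ_M ^ E_δ` at every level `N ∣ M` (`hpair`).  CONCLUSION: the (U3) data `(c, u, r)` and
`Z ∈ 𝔥_g` with `IsAdmissibleAt hδ r Z hZ P′`.  Proof: a symplectic lift `Λ₀` of `P′.level` for `Θ` exists
(`P′.symplectic`); the frame change ★ `exists_pairingRead_of_pairingRead` (`b ↦ a₀`) feeds ★
`exists_frame_of_symplecticLift`, giving `k₀ ∈ K_δ(1)` through which `Λ₀`'s tower is read; ★
`exists_isAdmissibleAt_of_frame` at level `N`. [cite: Milne2005ShimuraVarieties, §6 Thm. 6.11 pp. 74–75 and §12 (63) p. 116]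
[cite: Deligne1971TravauxShimura, 4.12 (b) pp. 148–149 and 4.16 p. 150] [cite: Lan2013PELCompactifications, §1.3.6 Lemma 1.3.6.5 (p. 81)] -/
theorem exists_isAdmissibleAt_of_pairingRead (hδ : IsPolarizationType δ) (hg : 0 < g) {N : ℕ} (hN : N ≠ 0)
    (P' : PolarizedAbelianSchemeWithLevel g N δ (specOver ℚ ℂ).left)
    (Θ : CartierDivisor (P'.A.fibre (𝟙 (Spec (CommRingCat.of ℂ)))).toAbelianVariety.X.left) (hΘ : Θ.IsAmple)
    (hlam : P'.A.IsLambdaOfAt (𝟙 (Spec (CommRingCat.of ℂ))) P'.D P'.pol.lam Θ)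
    (Z₀ : siegelUpperHalfSpace g) {a₀ : gspFinAdelic δ} (ha₀ : a₀ ∈ principalLevelSubgroup δ 1)
    (m₀ : SiegelAdelicMarking ⟨jOfSiegel δ Z₀, jOfSiegel_coe_mem_C0pm hδ.1 Z₀⟩ a₀
      (P'.A.fibre (𝟙 (Spec (CommRingCat.of ℂ)))).toAbelianVariety)
    {b : gspFinAdelic δ} (hb : b ∈ principalLevelSubgroup δ 1)
    (ζ : ℕ → ℂ) (hζ : ∀ ⦃M : ℕ⦄, N ∣ M → M ≠ 0 → IsPrimitiveRoot (ζ M) M)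
    (hζ_pow : ∀ ⦃M : ℕ⦄ (k : ℕ), N ∣ M → M ≠ 0 → k ≠ 0 → ζ (k * M) ^ k = ζ M)
    (hpair : ∀ ⦃M : ℕ⦄, N ∣ M → ∀ (hMΩ : (M : ℂ) ≠ 0) (x y : Fin g ⊕ Fin g → ZMod M)
      (P Q : (P'.A.fibre (𝟙 (Spec (CommRingCat.of ℂ)))).toAbelianVariety.torsionPoints ℂ (M : ℤ)),
      (∀ v, AdelicCongr ((b⁻¹ : gspFinAdelic δ) : GL (Fin g ⊕ Fin g) finAdeleQ) 1 v
          (fun i => ((x i).val : ℚ) / M) →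
          (P : (P'.A.fibre (𝟙 (Spec (CommRingCat.of ℂ)))).toAbelianVariety.Points ℂ) = m₀.r v) →
      (∀ w, AdelicCongr ((b⁻¹ : gspFinAdelic δ) : GL (Fin g ⊕ Fin g) finAdeleQ) 1 w
          (fun i => ((y i).val : ℚ) / M) →
          (Q : (P'.A.fibre (𝟙 (Spec (CommRingCat.of ℂ)))).toAbelianVariety.Points ℂ) = m₀.r w) →
      haveI := AbelianVariety.isDominant_toSchemeHom_zsmul_of_ne_zero
        (P'.A.fibre (𝟙 (Spec (CommRingCat.of ℂ)))).toAbelianVariety hMΩ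
      (P'.A.fibre (𝟙 (Spec (CommRingCat.of ℂ)))).toAbelianVariety.weilPairingLevel Θ P Q =
        ζ M ^ (AbelianSchemeOver.typeFormMod δ M x y).val) :
    ∃ (c : (ZMod N)ˣ) (u : finAdeleQˣ) (r : gspFinAdelic δ),
      (∀ v, Valued.v ((u : finAdeleQ) v) = 1) ∧
      (u : finAdeleQ) - ((c : ZMod N).val : ℕ) ∈ levelIdeal N ∧
      r ∈ principalLevelSubgroup δ 1 ∧
      IsMultiplier (typeFormOver δ finAdeleQ) (r : GL (Fin g ⊕ Fin g) finAdeleQ) u ∧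
      ((r : GL (Fin g ⊕ Fin g) finAdeleQ) : Matrix (Fin g ⊕ Fin g) (Fin g ⊕ Fin g) finAdeleQ) =
        Matrix.fromBlocks 1 0 0 ((u : finAdeleQ) • (1 : Matrix (Fin g) (Fin g) finAdeleQ)) ∧
      ∃ (Z : Matrix (Fin g) (Fin g) ℂ) (hZ : Z ∈ siegelUpperHalfSpace g), IsAdmissibleAt hδ r Z hZ P' := by
  -- a symplectic lift of the level structure for `Θ` (liftability is a field of `P′`)
  obtain ⟨Λ₀⟩ := P'.symplectic.nonempty (𝟙 (Spec (CommRingCat.of ℂ))) hΘ hlam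
  -- the pairing readings through the marking's own index `a₀`
  obtain ⟨ζ₁, hζ₁, hζ₁_pow, hpair₁⟩ :=
    m₀.exists_pairingRead_of_pairingRead hδ hg Θ hb ha₀ ζ hζ hζ_pow hpair
  -- the integral frame through which `Λ₀`'s tower is read
  obtain ⟨k₀, hk₀, hframe⟩ :=
    SiegelAdelicMarking.exists_frame_of_symplecticLift hN ha₀ Λ₀ m₀ ζ₁ hζ₁ hζ₁_pow hpair₁
  exact exists_isAdmissibleAt_of_frame hδ hg hN P' Θ hΘ hlam Z₀ ha₀ m₀ hb ζ hζ hζ_pow hpair Λ₀ hk₀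
    (fun x w hw => hframe (dvd_refl N) hN x w hw)

/-- **The same over the ample witnesses of the polarisation** (★ D2 `Polarization.exists_ample`: at the point `𝟙` of
`Spec ℂ` there IS an ample `Θ` with `λ̄ = Λ(𝒪(Θ))`): if for EVERY such witness `Θ` some level-one marking of the fibre
has pairing readings `ζ_M ^ E_δ` through some `b ∈ K_δ(1)` (the D5 identity in a Siegel normal form of `c₁(Θ^an)` of
type `δ`), then some principal representative is admissible for `P′`.
[cite: Milne2005ShimuraVarieties, §6 Thm. 6.11 pp. 74–75] [cite: Deligne1971TravauxShimura, 4.12 (b) pp. 148–149] -/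
theorem exists_isAdmissibleAt_of_pairingRead_of_polarization (hδ : IsPolarizationType δ) (hg : 0 < g) {N : ℕ}
    (hN : N ≠ 0) (P' : PolarizedAbelianSchemeWithLevel g N δ (specOver ℚ ℂ).left)
    (h : ∀ (Θ : CartierDivisor (P'.A.fibre (𝟙 (Spec (CommRingCat.of ℂ)))).toAbelianVariety.X.left),
      Θ.IsAmple → P'.A.IsLambdaOfAt (𝟙 (Spec (CommRingCat.of ℂ))) P'.D P'.pol.lam Θ →
      ∃ (Z₀ : siegelUpperHalfSpace g) (a₀ : gspFinAdelic δ) (_ : a₀ ∈ principalLevelSubgroup δ 1)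
        (m₀ : SiegelAdelicMarking ⟨jOfSiegel δ Z₀, jOfSiegel_coe_mem_C0pm hδ.1 Z₀⟩ a₀
          (P'.A.fibre (𝟙 (Spec (CommRingCat.of ℂ)))).toAbelianVariety)
        (b : gspFinAdelic δ) (_ : b ∈ principalLevelSubgroup δ 1)
        (ζ : ℕ → ℂ), (∀ ⦃M : ℕ⦄, N ∣ M → M ≠ 0 → IsPrimitiveRoot (ζ M) M) ∧
          (∀ ⦃M : ℕ⦄ (k : ℕ), N ∣ M → M ≠ 0 → k ≠ 0 → ζ (k * M) ^ k = ζ M) ∧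
          ∀ ⦃M : ℕ⦄, N ∣ M → ∀ (hMΩ : (M : ℂ) ≠ 0) (x y : Fin g ⊕ Fin g → ZMod M)
            (P Q : (P'.A.fibre (𝟙 (Spec (CommRingCat.of ℂ)))).toAbelianVariety.torsionPoints ℂ (M : ℤ)),
            (∀ v, AdelicCongr ((b⁻¹ : gspFinAdelic δ) : GL (Fin g ⊕ Fin g) finAdeleQ) 1 v
                (fun i => ((x i).val : ℚ) / M) →
                (P : (P'.A.fibre (𝟙 (Spec (CommRingCat.of ℂ)))).toAbelianVariety.Points ℂ) = m₀.r v) →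
            (∀ w, AdelicCongr ((b⁻¹ : gspFinAdelic δ) : GL (Fin g ⊕ Fin g) finAdeleQ) 1 w
                (fun i => ((y i).val : ℚ) / M) →
                (Q : (P'.A.fibre (𝟙 (Spec (CommRingCat.of ℂ)))).toAbelianVariety.Points ℂ) = m₀.r w) →
            haveI := AbelianVariety.isDominant_toSchemeHom_zsmul_of_ne_zero
              (P'.A.fibre (𝟙 (Spec (CommRingCat.of ℂ)))).toAbelianVariety hMΩ
            (P'.A.fibre (𝟙 (Spec (CommRingCat.of ℂ)))).toAbelianVariety.weilPairingLevel Θ P Q =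
              ζ M ^ (AbelianSchemeOver.typeFormMod δ M x y).val) :
    ∃ (c : (ZMod N)ˣ) (u : finAdeleQˣ) (r : gspFinAdelic δ),
      (∀ v, Valued.v ((u : finAdeleQ) v) = 1) ∧
      (u : finAdeleQ) - ((c : ZMod N).val : ℕ) ∈ levelIdeal N ∧
      r ∈ principalLevelSubgroup δ 1 ∧
      IsMultiplier (typeFormOver δ finAdeleQ) (r : GL (Fin g ⊕ Fin g) finAdeleQ) u ∧
      ((r : GL (Fin g ⊕ Fin g) finAdeleQ) : Matrix (Fin g ⊕ Fin g) (Fin g ⊕ Fin g) finAdeleQ) =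
        Matrix.fromBlocks 1 0 0 ((u : finAdeleQ) • (1 : Matrix (Fin g) (Fin g) finAdeleQ)) ∧
      ∃ (Z : Matrix (Fin g) (Fin g) ℂ) (hZ : Z ∈ siegelUpperHalfSpace g), IsAdmissibleAt hδ r Z hZ P' := by
  obtain ⟨Θ, hΘ, hlam⟩ := P'.pol.exists_ample ℂ (𝟙 (Spec (CommRingCat.of ℂ)))
  obtain ⟨Z₀, a₀, ha₀, m₀, b, hb, ζ, hζ, hζ_pow, hpair⟩ := h Θ hΘ hlam
  exact exists_isAdmissibleAt_of_pairingRead hδ hg hN P' Θ hΘ hlam Z₀ ha₀ m₀ hb ζ hζ hζ_pow hpair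

/-- **ADMISSIBILITY FROM A NORMAL-FORM MARKING** — the pairing input of `exists_isAdmissibleAt_of_pairingRead`
DISCHARGED by the D5 normal form ★ `AbelianVariety.weilPairingLevel_eq_exp_pow_typeFormMod`
(`ē_M^Θ(φ″[x̃/M], φ″[ỹ/M]) = e(2πi/M) ^ E_δ(x, y)`).  DATA: `P′` over `Spec ℂ`, an ample `Θ` with `λ̄ = Λ(𝒪(Θ))` at the
point; a uniformisation `φ″ : ℝ^{2g}/ℤ^{2g} → A(ℂ)` of the fibre (`Φ″` its complex chart, `φ″` the analytification, additive)
with an Appell–Humbert datum `p` of `[𝒪(Θ)^an]` in `δ`-NORMAL FORM (`intGram Φ″ p.form = typeForm δ`: the lattice basis is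
symplectic of type `δ` for `E = c₁(Θ^an)` — [Lange2023AbelianVarietiesComplex] §3.1, Frobenius); and a level-one marking
`m₀` of the fibre by `[J(Z₀), a₀]` READING THROUGH `φ″` (`u₀(v) = φ″[ṽ]`; e.g. ★ `exists_siegelAdelicMarking_of_addEquiv`
on the Siegel normal form of `(Φ″, E)`).  CONCLUSION: the (U3) data `(c, u, r)` and `Z ∈ 𝔥_g` with
`IsAdmissibleAt hδ r Z hZ P′`.  Proof: a point read at `x̃/M` through `b = 1` is `u₀(x̃/M) = φ″[x̃/M]`, so ★ B-p05's normal
form gives `hpair` with `ζ_M = e(2πi/M)` (primitive, `ζ_{kM}^k = ζ_M`); then `exists_isAdmissibleAt_of_pairingRead`.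
[cite: Milne2005ShimuraVarieties, §6 Thm. 6.11 pp. 74–75 and §12 (63) p. 116] [cite: Deligne1971TravauxShimura, 4.12 (b) pp. 148–149 and 4.16 p. 150]
[cite: Lan2013PELCompactifications, §1.3.6 Def. 1.3.6.2 (p. 80) and Lemma 1.3.6.5 (p. 81)] -/
theorem exists_isAdmissibleAt_of_normalForm (hδ : IsPolarizationType δ) (hg : 0 < g) {N : ℕ} (hN : N ≠ 0)
    (P' : PolarizedAbelianSchemeWithLevel g N δ (specOver ℚ ℂ).left)
    (Θ : CartierDivisor (P'.A.fibre (𝟙 (Spec (CommRingCat.of ℂ)))).toAbelianVariety.X.left) (hΘ : Θ.IsAmple)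
    (hlam : P'.A.IsLambdaOfAt (𝟙 (Spec (CommRingCat.of ℂ))) P'.D P'.pol.lam Θ)
    {Φ'' : (Fin g ⊕ Fin g → ℝ) ≃L[ℝ] (Fin (P'.A.fibre (𝟙 (Spec (CommRingCat.of ℂ)))).toAbelianVariety.dim → ℂ)}
    {φ'' : Literature.Geometry.Kaehler.ComplexTorus Φ'' →
      Literature.AlgebraicGeometry.Motives.ComplexPoints (P'.A.fibre (𝟙 (Spec (CommRingCat.of ℂ)))).toAbelianVariety.X}
    (hφ'' : Literature.NumberTheory.Transcendental.IsAnalytification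
      (Fin (P'.A.fibre (𝟙 (Spec (CommRingCat.of ℂ)))).toAbelianVariety.dim → ℂ)
      (P'.A.fibre (𝟙 (Spec (CommRingCat.of ℂ)))).toAbelianVariety.X
      (P'.A.fibre (𝟙 (Spec (CommRingCat.of ℂ)))).toAbelianVariety.dim φ'')
    (hadd'' : ∀ x y, φ'' (x + y) = φ'' x * φ'' y)
    (p : Literature.Geometry.Kaehler.ComplexTorus.AHData Φ'')
    (hp : Literature.Geometry.Kaehler.ComplexTorus.AHData.toPic p =
      Literature.Geometry.Kaehler.ComplexTorus.picClass
        (Literature.AlgebraicGeometry.HodgeTheory.cartierDivisorLineBundle hφ'' Θ))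
    (hT : Literature.Geometry.Kaehler.ComplexTorus.intGram Φ'' p.form = typeForm δ)
    (Z₀ : siegelUpperHalfSpace g) {a₀ : gspFinAdelic δ} (ha₀ : a₀ ∈ principalLevelSubgroup δ 1)
    (m₀ : SiegelAdelicMarking ⟨jOfSiegel δ Z₀, jOfSiegel_coe_mem_C0pm hδ.1 Z₀⟩ a₀
      (P'.A.fibre (𝟙 (Spec (CommRingCat.of ℂ)))).toAbelianVariety)
    (hr : ∀ v : Fin g ⊕ Fin g → ℚ,
      m₀.r v = φ'' (Literature.Geometry.Kaehler.ComplexTorus.proj Φ'' fun i => ((v i : ℚ) : ℝ))) :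
    ∃ (c : (ZMod N)ˣ) (u : finAdeleQˣ) (r : gspFinAdelic δ),
      (∀ v, Valued.v ((u : finAdeleQ) v) = 1) ∧
      (u : finAdeleQ) - ((c : ZMod N).val : ℕ) ∈ levelIdeal N ∧
      r ∈ principalLevelSubgroup δ 1 ∧
      IsMultiplier (typeFormOver δ finAdeleQ) (r : GL (Fin g ⊕ Fin g) finAdeleQ) u ∧
      ((r : GL (Fin g ⊕ Fin g) finAdeleQ) : Matrix (Fin g ⊕ Fin g) (Fin g ⊕ Fin g) finAdeleQ) =
        Matrix.fromBlocks 1 0 0 ((u : finAdeleQ) • (1 : Matrix (Fin g) (Fin g) finAdeleQ)) ∧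
      ∃ (Z : Matrix (Fin g) (Fin g) ℂ) (hZ : Z ∈ siegelUpperHalfSpace g), IsAdmissibleAt hδ r Z hZ P' := by
  -- the roots of unity `ζ_M = e(2πi/M)`
  set ζ : ℕ → ℂ := fun M => Complex.exp (2 * Real.pi * Complex.I / M) with hζ_def
  have hζ : ∀ ⦃M : ℕ⦄, N ∣ M → M ≠ 0 → IsPrimitiveRoot (ζ M) M := fun M _ hM =>
    Complex.isPrimitiveRoot_exp M hM
  have hζ_pow : ∀ ⦃M : ℕ⦄ (k : ℕ), N ∣ M → M ≠ 0 → k ≠ 0 → ζ (k * M) ^ k = ζ M := by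
    intro M k _ hM hk
    have hMc : (M : ℂ) ≠ 0 := Nat.cast_ne_zero.2 hM
    have hkc : (k : ℂ) ≠ 0 := Nat.cast_ne_zero.2 hk
    simp only [hζ_def]
    rw [← Complex.exp_nat_mul]
    congr 1
    push_cast
    field_simp
  -- reading through `b = 1` is the identity on classes
  have hone : ∀ v : Fin g ⊕ Fin g → ℚ,
      AdelicCongr (((1 : gspFinAdelic δ)⁻¹ : gspFinAdelic δ) : GL (Fin g ⊕ Fin g) finAdeleQ) 1 v v := by
    intro v i
    rw [inv_one, OneMemClass.coe_one, Pi.sub_apply, sub_self]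
    exact zero_mem _
  -- the rational lattice coordinates `x̃/M` in B-p05's spelling
  have hvec : ∀ {M : ℕ} (x : Fin g ⊕ Fin g → ZMod M),
      (fun i => ((((fun j => ((x j).val : ℚ) / M) i : ℚ) : ℝ))) = (M : ℝ)⁻¹ • fun i => ((x i).val : ℝ) := by
    intro M x
    funext i
    simp only [Pi.smul_apply, smul_eq_mul, Rat.cast_div, Rat.cast_natCast]
    ring
  have hpair : ∀ ⦃M : ℕ⦄, N ∣ M → ∀ (hMΩ : (M : ℂ) ≠ 0) (x y : Fin g ⊕ Fin g → ZMod M)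
      (P Q : (P'.A.fibre (𝟙 (Spec (CommRingCat.of ℂ)))).toAbelianVariety.torsionPoints ℂ (M : ℤ)),
      (∀ v, AdelicCongr (((1 : gspFinAdelic δ)⁻¹ : gspFinAdelic δ) : GL (Fin g ⊕ Fin g) finAdeleQ) 1 v
          (fun i => ((x i).val : ℚ) / M) → (P : (P'.A.fibre (𝟙 (Spec (CommRingCat.of ℂ)))).toAbelianVariety.Points ℂ) = m₀.r v) →
      (∀ w, AdelicCongr (((1 : gspFinAdelic δ)⁻¹ : gspFinAdelic δ) : GL (Fin g ⊕ Fin g) finAdeleQ) 1 w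
          (fun i => ((y i).val : ℚ) / M) → (Q : (P'.A.fibre (𝟙 (Spec (CommRingCat.of ℂ)))).toAbelianVariety.Points ℂ) = m₀.r w) →
      haveI := AbelianVariety.isDominant_toSchemeHom_zsmul_of_ne_zero (P'.A.fibre (𝟙 (Spec (CommRingCat.of ℂ)))).toAbelianVariety hMΩ
      (P'.A.fibre (𝟙 (Spec (CommRingCat.of ℂ)))).toAbelianVariety.weilPairingLevel Θ P Q = ζ M ^ (AbelianSchemeOver.typeFormMod δ M x y).val := by
    intro M hNM hMΩ x y P Q hP hQ
    have hM : M ≠ 0 := by rintro rfl; exact hMΩ Nat.cast_zero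
    haveI := AbelianVariety.isDominant_toSchemeHom_zsmul_of_ne_zero (P'.A.fibre (𝟙 (Spec (CommRingCat.of ℂ)))).toAbelianVariety hMΩ
    have hPx := hP _ (hone _)
    have hQy := hQ _ (hone _)
    rw [hr, hvec] at hPx
    rw [hr, hvec] at hQy
    exact AbelianVariety.weilPairingLevel_eq_exp_pow_typeFormMod hφ'' hadd'' hM Θ p hp hT x y P Q hPx hQy
  exact exists_isAdmissibleAt_of_pairingRead hδ hg hN P' Θ hΘ hlam Z₀ ha₀ m₀ (one_mem _) ζ hζ hζ_pow hpair

end Literature.AlgebraicGeometry.ModuliOfAbelianVarieties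

end
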